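import Summits.AtomisticToContinuum.Crystallization.Theorems.ThreeConeCertificateExactCertificateSlacknessEnergy

/-!
# `ExactCertificate` (stmt-AtomisticToContinuum-11959), line `closure-makes-nogap-exact`:
# complementary slackness of a witness, III — the `f`-weighted structure factor

For a three-cone split `IsSplit ρ c g U f` whose value attains a periodic configuration,
`c + f 0 / 2 ≤ −e(P)`, the `f`-weighted structure factor of the template
`S_f(k) = f 0 + (#F)⁻¹ Σ_{x ∈ F} Σ'_{y ∈ P, y ≠ x} cos⟪k, x − y⟫ · f(|x − y|)` is `≥ 0` for every
wave vector `k ∈ ℝ³` and `= 0` at `k = 0` (registered stub `stub_structureFactor`): Fourier-side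
complementary slackness without Fourier transforms.  Mechanism: test (S4) on the `K`-blocks of `P`
with the weights `cos⟪k, ·⟫`, `sin⟪k, ·⟫` and add — the double block sum
`D_K = Σ_{u,v} cos⟪k, u − v⟫ f(|u − v|)` is `≥ 0`; its diagonal is `N_K · f 0`, each row is the
translation-invariant absolutely summable periodic site sum minus a tail over the points outside
the block, and `Σ_u |tail_u| ≤ K³ · Σ_x Far_R(x) + 6ρ'(R)K² · Σ_x A(x) = o(K³)` (far parts at deep
points, full `|f|`-site sums at the `≤ 6ρ'K²` others).  The value at `k = 0` is
`f 0 + 2e_f(P) = 0` (`Slackness.f_zero_add_two_mul_energyPerParticle_f`).  All `[folklore]`; the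
block machinery is that of `ChargedEnergyGap/Negative/Blocks*` with `r⁻⁶` replaced by `|f|`.
-/

noncomputable section

namespace Summit.AtomisticToContinuum.Crystallization.Theorems.ThreeConeCertificateExactCertificate.Fourier

open Literature.MathematicalPhysics.StatisticalMechanics
open Summit.AtomisticToContinuum.Crystallization.Theses.ThreeConeCertificate
open Summit.AtomisticToContinuum.Crystallization.Theorems.ChargedEnergyGapNegative (E3)
open Summit.AtomisticToContinuum.Crystallization.Theorems.ChargedEnergyGapNegative.Blocks
  (BIdx bpt bpt_mem bpt_injective blockConfig blockConfig_apply card_BIdx latVec latVec_mem coords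
    shiftEquiv farShiftEquiv siteSum siteSum_bpt blockOthers tail IsDeep depth le_dist_of_deep
    card_not_deep_le tsum_subtype_mono)
open Summit.AtomisticToContinuum.Crystallization.Theorems.ExactCertificateNegative (IsSplit)
open Summit.AtomisticToContinuum.Crystallization.Theorems.ThreeConeCertificateExactCertificate
  (Slackness.summable_f_site Slackness.f_zero_add_two_mul_energyPerParticle_f
    Slackness.nonpos_of_cubic_le_sq)
open scoped BigOperators

/-! ## Site families of a kernel depending on `x − q` -/

section Kernel

variable (P : PeriodicConfiguration 3)

/-- The block part of a site family is the finite sum over the other block points (non-radial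
version of `Blocks.sum_blockOthers`). [folklore] -/
theorem sum_blockOthers_apply (K : ℕ) (u : BIdx P K) (φ : E3 → ℝ) :
    ∑ q ∈ blockOthers P K u, φ q.1 = ∑ v ∈ Finset.univ.erase u, φ (bpt P K v) := by
  unfold blockOthers
  rw [Finset.sum_image]
  · exact Finset.sum_attach (Finset.univ.erase u) fun v => φ (bpt P K v)
  · intro v _ w _ h
    exact Subtype.ext ((bpt_injective P K) (congrArg Subtype.val h))

/-- **Translation invariance** of the site sums of a kernel depending on `x − q` and `dist x q`
only. [folklore] -/
theorem tsum_site_add (κ : E3 → ℝ → ℝ) {γ : E3} (hγ : γ ∈ P.lattice) (x : E3) :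
    ∑' q : {q : E3 // q ∈ P.points ∧ q ≠ x + γ}, κ (x + γ - q.1) (dist (x + γ) q.1) =
      ∑' q : {q : E3 // q ∈ P.points ∧ q ≠ x}, κ (x - q.1) (dist x q.1) := by
  rw [← Equiv.tsum_eq (shiftEquiv P hγ x)]
  congr 1
  funext q
  simp [shiftEquiv, dist_add_right, add_sub_add_right_eq_sub]

/-- Translation invariance of the far parts of a radial site family. [folklore] -/
theorem tsum_far_add (W : ℝ → ℝ) {γ : E3} (hγ : γ ∈ P.lattice) (x : E3) (R : ℝ) :
    ∑' q : {q : {q : E3 // q ∈ P.points ∧ q ≠ x + γ} // R ≤ dist (x + γ) q.1},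
        W (dist (x + γ) q.1.1) =
      ∑' q : {q : {q : E3 // q ∈ P.points ∧ q ≠ x} // R ≤ dist x q.1}, W (dist x q.1.1) := by
  rw [← Equiv.tsum_eq (farShiftEquiv P hγ x R)]
  congr 1
  funext q
  simp [farShiftEquiv, shiftEquiv, dist_add_right]

variable (k : E3) (f : ℝ → ℝ)

/-- The oscillating kernel is dominated by `|f|`. [folklore] -/
theorem norm_kernel_le (v : E3) (r : ℝ) : ‖Real.cos (inner ℝ k v) * f r‖ ≤ |f r| := by
  rw [Real.norm_eq_abs, abs_mul]
  exact mul_le_of_le_one_left (abs_nonneg _) (Real.abs_cos_le_one _)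

/-- The oscillating site family is summable as soon as the `f`-site family is. [folklore] -/
theorem summable_kernel {x : E3}
    (hs : Summable fun q : {q : E3 // q ∈ P.points ∧ q ≠ x} => f (dist x q.1)) :
    Summable fun q : {q : E3 // q ∈ P.points ∧ q ≠ x} =>
      Real.cos (inner ℝ k (x - q.1)) * f (dist x q.1) :=
  Summable.of_norm_bounded hs.abs fun q => norm_kernel_le k f (x - q.1) (dist x q.1)

/-- **Row identity** at a block point: site sum = block part + tail. [folklore] -/
theorem tsum_kernel_bpt_eq (K : ℕ) (u : BIdx P K)
    (hs : Summable fun q : {q : E3 // q ∈ P.points ∧ q ≠ bpt P K u} =>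
      f (dist (bpt P K u) q.1)) :
    ∑' q : {q : E3 // q ∈ P.points ∧ q ≠ bpt P K u},
        Real.cos (inner ℝ k (bpt P K u - q.1)) * f (dist (bpt P K u) q.1) =
      ∑ v ∈ Finset.univ.erase u,
          Real.cos (inner ℝ k (bpt P K u - bpt P K v)) * f (dist (bpt P K u) (bpt P K v)) +
        ∑' q : ((blockOthers P K u : Set {q : E3 // q ∈ P.points ∧ q ≠ bpt P K u})ᶜ : Set _),
          Real.cos (inner ℝ k (bpt P K u - q.1.1)) * f (dist (bpt P K u) q.1.1) := by
  rw [← sum_blockOthers_apply P K u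
      (fun q => Real.cos (inner ℝ k (bpt P K u - q)) * f (dist (bpt P K u) q)),
    (summable_kernel P k f hs).sum_add_tsum_compl]

/-- The tail of the oscillating family is bounded by the `|f|`-tail. [folklore] -/
theorem abs_tail_kernel_le (K : ℕ) (u : BIdx P K)
    (hs : Summable fun q : {q : E3 // q ∈ P.points ∧ q ≠ bpt P K u} =>
      f (dist (bpt P K u) q.1)) :
    |∑' q : ((blockOthers P K u : Set {q : E3 // q ∈ P.points ∧ q ≠ bpt P K u})ᶜ : Set _),
        Real.cos (inner ℝ k (bpt P K u - q.1.1)) * f (dist (bpt P K u) q.1.1)| ≤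
      tail P K (fun r => |f r|) u := by
  unfold tail
  rw [← Real.norm_eq_abs]
  exact tsum_of_norm_bounded
    ((hs.abs.subtype ((blockOthers P K u : Set {q : E3 // q ∈ P.points ∧ q ≠ bpt P K u})ᶜ)).hasSum)
    fun q => norm_kernel_le k f _ _

/-- The `|f|`-tail is at most the full `|f|`-site sum at the motif point. [folklore] -/
theorem tail_abs_le_siteSum (K : ℕ) (u : BIdx P K)
    (hs : Summable fun q : {q : E3 // q ∈ P.points ∧ q ≠ bpt P K u} =>
      f (dist (bpt P K u) q.1)) :
    tail P K (fun r => |f r|) u ≤ siteSum P (fun r => |f r|) u.1 := by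
  rw [← siteSum_bpt P K (fun r => |f r|) u]
  unfold tail siteSum
  exact hs.abs.tsum_subtype_le
    (fun q : {q : E3 // q ∈ P.points ∧ q ≠ bpt P K u} => |f (dist (bpt P K u) q.1)|)
    ((blockOthers P K u : Set {q : E3 // q ∈ P.points ∧ q ≠ bpt P K u})ᶜ)
    (fun _ => abs_nonneg _)

/-- At a deep block point the `|f|`-tail is at most the far part of the `|f|`-site family at the
motif point. [folklore] -/
theorem tail_abs_le_far (K : ℕ) (u : BIdx P K) {R : ℝ} (hdeep : IsDeep K (depth P R) u.2)
    (hs : Summable fun q : {q : E3 // q ∈ P.points ∧ q ≠ bpt P K u} =>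
      f (dist (bpt P K u) q.1)) :
    tail P K (fun r => |f r|) u ≤
      ∑' q : {q : {q : E3 // q ∈ P.points ∧ q ≠ (u.1 : E3)} // R ≤ dist (u.1 : E3) q.1},
        |f (dist (u.1 : E3) q.1.1)| := by
  have h1 : tail P K (fun r => |f r|) u ≤
      ∑' q : {q : {q : E3 // q ∈ P.points ∧ q ≠ bpt P K u} // R ≤ dist (bpt P K u) q.1},
        |f (dist (bpt P K u) q.1.1)| := by
    unfold tail
    exact tsum_subtype_mono hs.abs (fun _ => abs_nonneg _)
      (fun q hq => le_dist_of_deep P K hdeep q (by simpa using hq))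
  have h2 := tsum_far_add P (fun r => |f r|) (latVec_mem P (coords K u.2)) (u.1 : E3) R
  rw [← h2]
  exact h1

/-- **The far parts tend to zero** (tails of a summable non-negative family). [folklore] -/
theorem exists_far_lt {x : E3}
    (hs : Summable fun q : {q : E3 // q ∈ P.points ∧ q ≠ x} => f (dist x q.1)) {ε : ℝ}
    (hε : 0 < ε) :
    ∃ R₀ : ℝ, ∀ R, R₀ ≤ R →
      ∑' q : {q : {q : E3 // q ∈ P.points ∧ q ≠ x} // R ≤ dist x q.1}, |f (dist x q.1.1)| < ε := by
  have ht : Filter.Tendsto (fun s : Finset {q : E3 // q ∈ P.points ∧ q ≠ x} =>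
      ∑' q : {q : {q : E3 // q ∈ P.points ∧ q ≠ x} // q ∉ s}, |f (dist x q.1.1)|)
      Filter.atTop (nhds 0) :=
    tendsto_tsum_compl_atTop_zero (fun q : {q : E3 // q ∈ P.points ∧ q ≠ x} => |f (dist x q.1)|)
  obtain ⟨s₀, hs₀⟩ := Filter.eventually_atTop.1 (ht.eventually (gt_mem_nhds hε))
  refine ⟨(∑ q' ∈ s₀, dist x q'.1) + 1, fun R hR => ?_⟩
  have h1 : (∑ q' ∈ s₀, dist x q'.1) < R := lt_of_lt_of_le (lt_add_one _) hR
  have hsub : ∀ q : {q : E3 // q ∈ P.points ∧ q ≠ x}, R ≤ dist x q.1 → q ∉ s₀ := by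
    intro q hq hqs
    have h2 := Finset.single_le_sum (s := s₀) (f := fun q' => dist x q'.1)
      (fun _ _ => dist_nonneg) hqs
    exact absurd (hq.trans h2) (not_le.2 h1)
  exact (tsum_subtype_mono hs.abs (fun _ => abs_nonneg _) hsub).trans_lt (hs₀ s₀ le_rfl)

end Kernel

/-! ## Block sums of a witness -/

section Witness

variable {P : PeriodicConfiguration 3} {ρ c : ℝ} {g U f : ℝ → ℝ}

/-- Over the motif, the far parts of the `|f|`-site families of a witness are eventually `≤ ε`.
[folklore] -/
theorem exists_sum_far_le (h : IsSplit ρ c g U f)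
    (hv : c + f 0 / 2 ≤ -(P.energyPerParticle lennardJones)) {ε : ℝ} (hε : 0 < ε) :
    ∃ R : ℝ, ∑ x ∈ P.motif,
      ∑' q : {q : {q : E3 // q ∈ P.points ∧ q ≠ x} // R ≤ dist x q.1}, |f (dist x q.1.1)| ≤ ε := by
  have ht : ∀ x ∈ P.motif, Filter.Tendsto (fun R : ℝ =>
      ∑' q : {q : {q : E3 // q ∈ P.points ∧ q ≠ x} // R ≤ dist x q.1}, |f (dist x q.1.1)|)
      Filter.atTop (nhds 0) := by
    intro x hx
    have hs := Slackness.summable_f_site h hv (P.mem_points_of_mem_motif hx)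
    refine tendsto_order.2 ⟨fun a ha => Filter.Eventually.of_forall fun R =>
      ha.trans_le (tsum_nonneg fun _ => abs_nonneg _), fun a ha => ?_⟩
    obtain ⟨R₀, hR₀⟩ := exists_far_lt P f hs ha
    exact Filter.eventually_atTop.2 ⟨R₀, hR₀⟩
  have hsum := tendsto_finsetSum P.motif ht
  rw [Finset.sum_const_zero] at hsum
  exact (hsum.eventually (Iic_mem_nhds hε)).exists

/-- Pointwise tail bound at `u = (x, κ)`: far part at `x` if `κ` is deep, plus the full `|f|`-site
sum at `x` otherwise. [folklore] -/
theorem abs_tail_kernel_le_ite (h : IsSplit ρ c g U f)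
    (hv : c + f 0 / 2 ≤ -(P.energyPerParticle lennardJones)) (k : E3) (K : ℕ) (R : ℝ)
    (u : BIdx P K) :
    |∑' q : ((blockOthers P K u : Set {q : E3 // q ∈ P.points ∧ q ≠ bpt P K u})ᶜ : Set _),
        Real.cos (inner ℝ k (bpt P K u - q.1.1)) * f (dist (bpt P K u) q.1.1)| ≤
      ∑' q : {q : {q : E3 // q ∈ P.points ∧ q ≠ (u.1 : E3)} // R ≤ dist (u.1 : E3) q.1},
          |f (dist (u.1 : E3) q.1.1)| +
        (if ¬ IsDeep K (depth P R) u.2 then 1 else 0) * siteSum P (fun r => |f r|) u.1 := by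
  have hs := Slackness.summable_f_site h hv (bpt_mem P K u)
  have h0 := abs_tail_kernel_le P k f K u hs
  by_cases hd : IsDeep K (depth P R) u.2
  · rw [if_neg (not_not_intro hd), zero_mul, add_zero]
    exact h0.trans (tail_abs_le_far P f K u hd hs)
  · rw [if_pos hd, one_mul]
    exact h0.trans ((tail_abs_le_siteSum P f K u hs).trans
      (le_add_of_nonneg_left (tsum_nonneg fun _ => abs_nonneg _)))

/-- **The total tail of a block is `o(K³)`**:
`Σ_u |tail_u| ≤ K³ · Σ_{x ∈ F} Far_R(x) + 6ρ'(R)K² · Σ_{x ∈ F} A(x)`. [folklore] -/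
theorem sum_abs_tail_kernel_le (h : IsSplit ρ c g U f)
    (hv : c + f 0 / 2 ≤ -(P.energyPerParticle lennardJones)) (k : E3) (K : ℕ) (R : ℝ) :
    ∑ u : BIdx P K,
        |∑' q : ((blockOthers P K u : Set {q : E3 // q ∈ P.points ∧ q ≠ bpt P K u})ᶜ : Set _),
          Real.cos (inner ℝ k (bpt P K u - q.1.1)) * f (dist (bpt P K u) q.1.1)| ≤
      (K : ℝ) ^ 3 * ∑ x ∈ P.motif,
          ∑' q : {q : {q : E3 // q ∈ P.points ∧ q ≠ x} // R ≤ dist x q.1}, |f (dist x q.1.1)| +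
        6 * depth P R * (K : ℝ) ^ 2 * ∑ x ∈ P.motif, siteSum P (fun r => |f r|) x := by
  classical
  have hnd := card_not_deep_le K (depth P R)
  have hA : ∀ x, 0 ≤ siteSum P (fun r => |f r|) x := fun x => tsum_nonneg fun _ => abs_nonneg _
  refine (Finset.sum_le_sum fun u _ => abs_tail_kernel_le_ite h hv k K R u).trans ?_
  calc ∑ u : BIdx P K,
          (∑' q : {q : {q : E3 // q ∈ P.points ∧ q ≠ (u.1 : E3)} // R ≤ dist (u.1 : E3) q.1},
              |f (dist (u.1 : E3) q.1.1)| +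
            (if ¬ IsDeep K (depth P R) u.2 then 1 else 0) * siteSum P (fun r => |f r|) u.1)
      = ∑ x : P.motif, ((K : ℝ) ^ 3 *
          ∑' q : {q : {q : E3 // q ∈ P.points ∧ q ≠ (x : E3)} // R ≤ dist (x : E3) q.1},
            |f (dist (x : E3) q.1.1)| +
          ((Finset.univ.filter fun κ : Fin 3 → Fin K => ¬ IsDeep K (depth P R) κ).card : ℝ) *
            siteSum P (fun r => |f r|) x) := by
        rw [Fintype.sum_prod_type]
        refine Finset.sum_congr rfl fun x _ => ?_
        dsimp only
        rw [Finset.sum_add_distrib, Finset.sum_const, Finset.card_univ, Fintype.card_fun,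
          Fintype.card_fin, Fintype.card_fin, nsmul_eq_mul, ← Finset.sum_mul, Finset.sum_boole]
        push_cast
        ring
    _ ≤ ∑ x : P.motif, ((K : ℝ) ^ 3 *
          ∑' q : {q : {q : E3 // q ∈ P.points ∧ q ≠ (x : E3)} // R ≤ dist (x : E3) q.1},
            |f (dist (x : E3) q.1.1)| +
          (6 * depth P R * (K : ℝ) ^ 2) * siteSum P (fun r => |f r|) x) := by
        refine Finset.sum_le_sum fun x _ => add_le_add le_rfl ?_
        exact mul_le_mul_of_nonneg_right (by exact_mod_cast hnd) (hA x)
    _ = (K : ℝ) ^ 3 * ∑ x ∈ P.motif,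
          ∑' q : {q : {q : E3 // q ∈ P.points ∧ q ≠ x} // R ≤ dist x q.1}, |f (dist x q.1.1)| +
        6 * depth P R * (K : ℝ) ^ 2 * ∑ x ∈ P.motif, siteSum P (fun r => |f r|) x := by
        rw [Finset.sum_add_distrib, ← Finset.mul_sum, ← Finset.mul_sum,
          Finset.sum_coe_sort P.motif (fun x => ∑' q : {q : {q : E3 // q ∈ P.points ∧ q ≠ x} //
            R ≤ dist x q.1}, |f (dist x q.1.1)|),
          Finset.sum_coe_sort P.motif (fun x => siteSum P (fun r => |f r|) x)]

/-- **Finite positivity on blocks**: testing (S4) with the weights `cos⟪k, ·⟫` and `sin⟪k, ·⟫`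
on the `K`-block gives `0 ≤ Σ_{u,v} cos⟪k, u − v⟫ f(|u − v|)`. [folklore] -/
theorem sum_sum_kernel_nonneg (h : IsSplit ρ c g U f) (k : E3) (K : ℕ) :
    0 ≤ ∑ u : BIdx P K, ∑ v : BIdx P K,
      Real.cos (inner ℝ k (bpt P K u - bpt P K v)) * f (dist (bpt P K u) (bpt P K v)) := by
  classical
  set y := blockConfig P K with hy
  have h1 : 0 ≤ ∑ i, ∑ j, Real.cos (inner ℝ k (y i)) * Real.cos (inner ℝ k (y j)) *
      f (dist (y i) (y j)) := h.posType _ y fun a => Real.cos (inner ℝ k (y a))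
  have h2 : 0 ≤ ∑ i, ∑ j, Real.sin (inner ℝ k (y i)) * Real.sin (inner ℝ k (y j)) *
      f (dist (y i) (y j)) := h.posType _ y fun a => Real.sin (inner ℝ k (y a))
  have h3 : 0 ≤ ∑ i, ∑ j, Real.cos (inner ℝ k (y i - y j)) * f (dist (y i) (y j)) := by
    have e : ∑ i, ∑ j, Real.cos (inner ℝ k (y i - y j)) * f (dist (y i) (y j)) =
        ∑ i, ∑ j, Real.cos (inner ℝ k (y i)) * Real.cos (inner ℝ k (y j)) * f (dist (y i) (y j)) +
        ∑ i, ∑ j, Real.sin (inner ℝ k (y i)) * Real.sin (inner ℝ k (y j)) *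
          f (dist (y i) (y j)) := by
      rw [← Finset.sum_add_distrib]
      refine Finset.sum_congr rfl fun i _ => ?_
      rw [← Finset.sum_add_distrib]
      refine Finset.sum_congr rfl fun j _ => ?_
      rw [inner_sub_right, Real.cos_sub]
      ring
    rw [e]
    exact add_nonneg h1 h2
  simp only [hy, blockConfig_apply] at h3
  set e := Fintype.equivFin (BIdx P K) with he
  have h4 : ∑ a, ∑ b, Real.cos (inner ℝ k (bpt P K (e.symm a) - bpt P K (e.symm b))) *
        f (dist (bpt P K (e.symm a)) (bpt P K (e.symm b))) =
      ∑ u : BIdx P K, ∑ v : BIdx P K,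
        Real.cos (inner ℝ k (bpt P K u - bpt P K v)) * f (dist (bpt P K u) (bpt P K v)) :=
    (e.symm.sum_comp (fun p => ∑ b, Real.cos (inner ℝ k (bpt P K p - bpt P K (e.symm b))) *
      f (dist (bpt P K p) (bpt P K (e.symm b))))).trans
      (Finset.sum_congr rfl fun p _ => e.symm.sum_comp (fun q =>
        Real.cos (inner ℝ k (bpt P K p - bpt P K q)) * f (dist (bpt P K p) (bpt P K q))))
  rw [← h4]
  exact h3

/-- **Block identity**: `D_K = N_K · f 0 + K³ · Σ_{x ∈ F} T(x) − Σ_u tail_u`, where `T(x)` is the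
oscillating periodic site sum at `x`. [folklore] -/
theorem sum_sum_kernel_eq (h : IsSplit ρ c g U f)
    (hv : c + f 0 / 2 ≤ -(P.energyPerParticle lennardJones)) (k : E3) (K : ℕ) :
    ∑ u : BIdx P K, ∑ v : BIdx P K,
        Real.cos (inner ℝ k (bpt P K u - bpt P K v)) * f (dist (bpt P K u) (bpt P K v)) =
      (Fintype.card (BIdx P K) : ℝ) * f 0 +
        (K : ℝ) ^ 3 * ∑ x ∈ P.motif, ∑' q : {q : E3 // q ∈ P.points ∧ q ≠ x},
          Real.cos (inner ℝ k (x - q.1)) * f (dist x q.1) -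
        ∑ u : BIdx P K,
          ∑' q : ((blockOthers P K u : Set {q : E3 // q ∈ P.points ∧ q ≠ bpt P K u})ᶜ : Set _),
            Real.cos (inner ℝ k (bpt P K u - q.1.1)) * f (dist (bpt P K u) q.1.1) := by
  classical
  have hrow : ∀ u : BIdx P K, ∑ v : BIdx P K,
      Real.cos (inner ℝ k (bpt P K u - bpt P K v)) * f (dist (bpt P K u) (bpt P K v)) =
      f 0 + (∑' q : {q : E3 // q ∈ P.points ∧ q ≠ (u.1 : E3)},
          Real.cos (inner ℝ k ((u.1 : E3) - q.1)) * f (dist (u.1 : E3) q.1) -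
        ∑' q : ((blockOthers P K u : Set {q : E3 // q ∈ P.points ∧ q ≠ bpt P K u})ᶜ : Set _),
          Real.cos (inner ℝ k (bpt P K u - q.1.1)) * f (dist (bpt P K u) q.1.1)) := by
    intro u
    rw [← Finset.add_sum_erase _ _ (Finset.mem_univ u), sub_self, inner_zero_right, Real.cos_zero,
      one_mul, dist_self]
    congr 1
    rw [← tsum_site_add P (fun v r => Real.cos (inner ℝ k v) * f r) (latVec_mem P (coords K u.2))
      (u.1 : E3)]
    exact eq_sub_of_add_eq
      (tsum_kernel_bpt_eq P k f K u (Slackness.summable_f_site h hv (bpt_mem P K u))).symm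
  rw [Finset.sum_congr rfl fun u _ => hrow u, Finset.sum_add_distrib, Finset.sum_sub_distrib,
    Finset.sum_const, Finset.card_univ, nsmul_eq_mul, add_sub_assoc']
  congr 2
  rw [Fintype.sum_prod_type]
  simp only [Finset.sum_const, Finset.card_univ, Fintype.card_fun, Fintype.card_fin, nsmul_eq_mul]
  rw [← Finset.mul_sum, Finset.sum_coe_sort P.motif (fun x => ∑' q : {q : E3 // q ∈ P.points ∧
    q ≠ x}, Real.cos (inner ℝ k (x - q.1)) * f (dist x q.1))]
  push_cast
  ring

/-- **The main estimate**: for every `R` and every `K`,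
`0 ≤ K³ · (#F · f 0 + Σ_x T(x) + Σ_x Far_R(x)) + 6ρ'(R)K² · Σ_x A(x)`. [folklore] -/
theorem main_estimate (h : IsSplit ρ c g U f)
    (hv : c + f 0 / 2 ≤ -(P.energyPerParticle lennardJones)) (k : E3) (K : ℕ) (R : ℝ) :
    0 ≤ (K : ℝ) ^ 3 * ((P.motif.card : ℝ) * f 0 +
        ∑ x ∈ P.motif, ∑' q : {q : E3 // q ∈ P.points ∧ q ≠ x},
          Real.cos (inner ℝ k (x - q.1)) * f (dist x q.1) +
        ∑ x ∈ P.motif,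
          ∑' q : {q : {q : E3 // q ∈ P.points ∧ q ≠ x} // R ≤ dist x q.1}, |f (dist x q.1.1)|) +
      6 * depth P R * (K : ℝ) ^ 2 * ∑ x ∈ P.motif, siteSum P (fun r => |f r|) x := by
  have h1 := sum_sum_kernel_nonneg (P := P) h k K
  have h2 := sum_sum_kernel_eq h hv k K
  have h3 := sum_abs_tail_kernel_le h hv k K R
  have h4 := (neg_le_abs _).trans ((Finset.abs_sum_le_sum_abs _ _).trans h3)
  have hcard : ((Fintype.card (BIdx P K) : ℕ) : ℝ) = (P.motif.card : ℝ) * (K : ℝ) ^ 3 := by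
    rw [card_BIdx]; push_cast; ring
  rw [hcard] at h2
  linarith

/-- **`S_f(k) ≥ 0`**: the `f`-weighted structure factor of a witness template is non-negative
(`R → ∞` after `K → ∞` in the main estimate). [folklore] -/
theorem structureFactor_nonneg (h : IsSplit ρ c g U f)
    (hv : c + f 0 / 2 ≤ -(P.energyPerParticle lennardJones)) (k : E3) :
    0 ≤ f 0 + ((P.motif.card : ℝ))⁻¹ * ∑ x ∈ P.motif,
      ∑' q : {q : E3 // q ∈ P.points ∧ q ≠ x},
        Real.cos (inner ℝ k (x - q.1)) * f (dist x q.1) := by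
  have hF : (0 : ℝ) < P.motif.card := by exact_mod_cast P.motif_nonempty.card_pos
  suffices hS : 0 ≤ (P.motif.card : ℝ) * f 0 + ∑ x ∈ P.motif,
      ∑' q : {q : E3 // q ∈ P.points ∧ q ≠ x}, Real.cos (inner ℝ k (x - q.1)) * f (dist x q.1) by
    have hmul := mul_nonneg (inv_nonneg.2 hF.le) hS
    rwa [mul_add, ← mul_assoc, inv_mul_cancel₀ hF.ne', one_mul] at hmul
  refine le_of_forall_pos_le_add fun ε hε => ?_
  obtain ⟨R, hR⟩ := exists_sum_far_le h hv hε
  have hcub : -((P.motif.card : ℝ) * f 0 + ∑ x ∈ P.motif,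
      ∑' q : {q : E3 // q ∈ P.points ∧ q ≠ x}, Real.cos (inner ℝ k (x - q.1)) * f (dist x q.1) +
        ε) ≤ 0 := by
    refine Slackness.nonpos_of_cubic_le_sq
      (b := 6 * depth P R * ∑ x ∈ P.motif, siteSum P (fun r => |f r|) x) ⟨0, fun K _ => ?_⟩
    have h1 := main_estimate h hv k K R
    have h5 := mul_le_mul_of_nonneg_left hR (by positivity : (0 : ℝ) ≤ (K : ℝ) ^ 3)
    nlinarith [h1, h5]
  linarith

/-- **`S_f(0) = 0`**: `f 0 + (#F)⁻¹ Σ_x Σ'_y f(|x − y|) = f 0 + 2e_f(P) = 0`. [folklore] -/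
theorem structureFactor_zero (h : IsSplit ρ c g U f)
    (hv : c + f 0 / 2 ≤ -(P.energyPerParticle lennardJones)) :
    f 0 + ((P.motif.card : ℝ))⁻¹ * ∑ x ∈ P.motif,
      ∑' y : {y : E3 // y ∈ P.points ∧ y ≠ x}, f (dist x y.1) = 0 := by
  have h1 := Slackness.f_zero_add_two_mul_energyPerParticle_f h hv
  unfold PeriodicConfiguration.energyPerParticle at h1
  rw [mul_inv] at h1
  linear_combination h1

end Witness

/-- **Registered stub `stub_structureFactor` of the line `closure-makes-nogap-exact`** (signature
verbatim): the `f`-weighted structure factor of a witness template is non-negative for every wave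
vector and vanishes at `k = 0` — Fourier-side complementary slackness. [folklore] -/
theorem stub_structureFactor : ∀ (P : PeriodicConfiguration 3) (ρ c : ℝ) (g U f : ℝ → ℝ),
    IsSplit ρ c g U f → c + f 0 / 2 ≤ -(P.energyPerParticle lennardJones) →
    (∀ k : EuclideanSpace ℝ (Fin 3),
      0 ≤ f 0 + ((P.motif.card : ℝ))⁻¹ * ∑ x ∈ P.motif,
        ∑' y : {y : EuclideanSpace ℝ (Fin 3) // y ∈ P.points ∧ y ≠ x},
          Real.cos (inner ℝ k (x - y.1)) * f (dist x y.1)) ∧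
    f 0 + ((P.motif.card : ℝ))⁻¹ * ∑ x ∈ P.motif,
        ∑' y : {y : EuclideanSpace ℝ (Fin 3) // y ∈ P.points ∧ y ≠ x}, f (dist x y.1) = 0 :=
  fun _ _ _ _ _ _ h hv => ⟨structureFactor_nonneg h hv, structureFactor_zero h hv⟩

end Summit.AtomisticToContinuum.Crystallization.Theorems.ThreeConeCertificateExactCertificate.Fourier

end
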